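import Mathlib
import Summits.NavierStokesRegularity.NavierStokesRegularity.Theorems.EulerZoomLiouvillePowerGaugeEulerLiouvilleSelfSimilarEndpointDecay
import HarnessLib

/-!
# Rung C2 of the crux `EulerZoomLiouville.PowerGaugeEulerLiouville` at the endpoint `ρ = 1/2`:
# tools for the period-energy bootstrap of DISCRETELY self-similar members

Route №10 `EulerZoomLiouville` (NavierStokesRegularity), crux E = stmt-NavierStokesRegularity-19832,
tenure rung C2 (`Sig.rungC2_dss`) at the energy-conserving endpoint `ρ = 1/2`.  The DSS endpoint
stratum (`…DSSEndpointShell`, `…DSSEndpointDecay`, `…DSSEndpointMember`) runs Chae–Shvydkoy's shell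
bootstrap on the PERIOD-INTEGRATED shell energies `f(L) = ∫_{I₀} ∫_{L ≤ |y| < 2L} |u(τ)|² dτ` of a
discretely self-similar member over one period `I₀`; the per-slice inputs are the lineage's
endpoint tools (`shell_cubic_le`, `shell_pressure_le`).  Tools of this file:

* `setIntegral_le_windowSum` — a shell `{A ≤ |y| < B}` inside the dyadic window
  `[2^{−m} L, 2^{m+1} L)` is covered by the `2m+1` dyadic shells (general `m`; the lineage's
  `windowSum_ge_setIntegral` is `m = 5`);
* `integral_sqrt_le` — `∫_I √g ≤ √(|I| ∫_I g)` for `g ≥ 0` (Cauchy–Schwarz by completing a square);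
* `shell_flux_le_slice` — ONE SLICE: cubic + pressure flux density on the shell `{M/4 ≤ |y| ≤ 8M}`
  of a field `V ∈ L² ∩ L³_loc` with `|P||V| ∈ L¹_loc`, the Riesz representation of `P` at scale
  `32M` and the sublinear far-field bound `|V| ≤ C_up |y|^{1−δ}`:
  `∫_{M ≤ |y| ≤ 2M} (|V|³ + 2|P||V|) ≤ a M^{1−δ} e(T_M) + b M^{−3/2} ‖V‖₂² √(e(T_M))`,
  `T_M = {M/8 ≤ |y| < 32M}`
  (the lineage's `shell_cubic_le` + `shell_pressure_le`, constants made scale-explicit).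

WHAT THIS IS NOT: not NS, not E, not rung C2 — bookkeeping for one endpoint stratum.
-/

noncomputable section

-- flat `Theorems/<Route><Decl>…` files of one crux share the namespace of the crux (tree convention)
set_option linter.dupNamespace false

open MeasureTheory Set Filter Topology Metric Function TopologicalSpace Finset
open scoped ENNReal NNReal InnerProductSpace RealInnerProductSpace

namespace Summit.NavierStokesRegularity.NavierStokesRegularity.Theorems.PowerGaugeEulerLiouville

open Literature.Analysis Literature.Analysis.FunctionSpaces Literature.Analysis.FluidPDE

/-! ## Dyadic window covering, general width -/

section Window

/-- **A shell inside the dyadic window is covered by the window's shells.**  For `g ≥ 0`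
integrable, `L > 0`, `m : ℕ` and `L/2^m ≤ A`, `B ≤ 2^{m+1} L`:
`∫_{A ≤ |y| < B} g ≤ Σ_{k=0}^{2m} ∫_{2^k L/2^m ≤ |y| < 2^{k+1} L/2^m} g`. [folklore] -/
theorem setIntegral_le_windowSum {g : EuclideanSpace ℝ (Fin 3) → ℝ} (hg0 : ∀ y, 0 ≤ g y)
    (hg : Integrable g volume) {L : ℝ} (hL : 0 < L) (m : ℕ) {A B : ℝ} (hA : L / 2 ^ m ≤ A)
    (hB : B ≤ 2 ^ (m + 1) * L) :
    ∫ y in {y | A ≤ ‖y‖ ∧ ‖y‖ < B}, g y ≤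
      ∑ k ∈ range (2 * m + 1),
        ∫ y in {y | 2 ^ k * L / 2 ^ m ≤ ‖y‖ ∧ ‖y‖ < 2 * (2 ^ k * L / 2 ^ m)}, g y := by
  set T : Set (EuclideanSpace ℝ (Fin 3)) := {y | A ≤ ‖y‖ ∧ ‖y‖ < B} with hT
  set S : ℕ → Set (EuclideanSpace ℝ (Fin 3)) := fun k =>
    {y | 2 ^ k * L / 2 ^ m ≤ ‖y‖ ∧ ‖y‖ < 2 * (2 ^ k * L / 2 ^ m)} with hS
  have hTm : MeasurableSet T := (measurableSet_le measurable_const measurable_norm).inter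
    (measurableSet_lt measurable_norm measurable_const)
  have hSm : ∀ k, MeasurableSet (S k) := fun k =>
    (measurableSet_le measurable_const measurable_norm).inter
      (measurableSet_lt measurable_norm measurable_const)
  have h2m : (0 : ℝ) < 2 ^ m := by positivity
  rw [← integral_indicator hTm]
  have hSk : ∀ k ∈ range (2 * m + 1),
      ∫ y in S k, g y = ∫ y, (S k).indicator g y := fun k _ => (integral_indicator (hSm k)).symm
  rw [sum_congr rfl hSk, ← integral_finsetSum _ (fun k _ => hg.indicator (hSm k))]
  refine integral_mono (hg.indicator hTm) (integrable_finsetSum _ fun k _ => hg.indicator (hSm k))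
    fun y => ?_
  by_cases hy : y ∈ T
  · have hy1 : 1 ≤ ‖y‖ / (L / 2 ^ m) := by
      rw [le_div_iff₀ (by positivity)]; linarith [hy.1]
    obtain ⟨k₀, hk₁, hk₂⟩ := exists_nat_pow_near hy1 (by norm_num : (1 : ℝ) < 2)
    have hk₀ : k₀ < 2 * m + 1 := by
      by_contra hge
      rw [not_lt] at hge
      have h2 : (2 : ℝ) ^ (2 * m + 1) ≤ (2 : ℝ) ^ k₀ := pow_le_pow_right₀ (by norm_num) hge
      have h3 : ‖y‖ / (L / 2 ^ m) < (2 : ℝ) ^ (2 * m + 1) := by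
        rw [div_lt_iff₀ (by positivity)]
        have : (2 : ℝ) ^ (2 * m + 1) * (L / 2 ^ m) = 2 ^ (m + 1) * L := by
          rw [pow_succ, pow_succ, two_mul, pow_add]
          field_simp
        rw [this]; linarith [hy.2]
      exact lt_irrefl _ ((h2.trans hk₁).trans_lt h3)
    have hyk : y ∈ S k₀ := by
      refine ⟨?_, ?_⟩
      · rw [le_div_iff₀ (by positivity)] at hk₁
        have : (2 : ℝ) ^ k₀ * L / 2 ^ m = 2 ^ k₀ * (L / 2 ^ m) := by ring
        rw [this]; exact hk₁
      · rw [div_lt_iff₀ (by positivity), pow_succ] at hk₂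
        have : 2 * ((2 : ℝ) ^ k₀ * L / 2 ^ m) = 2 ^ k₀ * 2 * (L / 2 ^ m) := by ring
        rw [this]; exact hk₂
    rw [indicator_of_mem hy]
    calc g y = (S k₀).indicator g y := by rw [indicator_of_mem hyk]
      _ ≤ ∑ k ∈ range (2 * m + 1), (S k).indicator g y :=
          single_le_sum (f := fun k => (S k).indicator g y)
            (fun k _ => indicator_nonneg (fun _ _ => hg0 _) _) (mem_range.2 hk₀)
  · rw [indicator_of_notMem hy]
    exact sum_nonneg fun k _ => indicator_nonneg (fun _ _ => hg0 _) _

end Window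

/-! ## `∫ √g ≤ √(|I| ∫ g)` -/

section Sqrt

/-- **Cauchy–Schwarz for a square root.**  For `g ≥ 0` integrable on a set `I ⊆ ℝ` of finite
measure, `∫_I √g ≤ √(vol(I) ∫_I g)` (complete the square `√g ≤ θ/2 + g/(2θ)` at
`θ = √(∫_I g / vol I)`). [folklore] -/
theorem integral_sqrt_le {I : Set ℝ} (hI : volume I ≠ ⊤) {g : ℝ → ℝ}
    (hg0 : ∀ᵐ t ∂(volume.restrict I), 0 ≤ g t) (hg : IntegrableOn g I volume) :
    ∫ t in I, Real.sqrt (g t) ≤ Real.sqrt (volume.real I * ∫ t in I, g t) := by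
  haveI : IsFiniteMeasure (volume.restrict I) := isFiniteMeasure_restrict.2 hI
  set W : ℝ := ∫ t in I, g t with hW
  set T : ℝ := volume.real I with hT
  have hW0 : 0 ≤ W := setIntegral_nonneg_of_ae_restrict hg0
  have hT0 : 0 ≤ T := measureReal_nonneg
  by_cases hWz : W = 0
  · have hae : ∀ᵐ t ∂(volume.restrict I), g t = 0 :=
      (integral_eq_zero_iff_of_nonneg_ae hg0 hg).1 hWz
    have h0 : ∫ t in I, Real.sqrt (g t) = 0 :=
      integral_eq_zero_of_ae (by filter_upwards [hae] with t ht; rw [ht, Real.sqrt_zero]; rfl)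
    rw [h0]; exact Real.sqrt_nonneg _
  have hWpos : 0 < W := lt_of_le_of_ne hW0 (Ne.symm hWz)
  have hTpos : 0 < T := by
    rcases eq_or_lt_of_le hT0 with h | h
    · exfalso
      have hI0 : volume I = 0 := (measureReal_eq_zero_iff hI).1 h.symm
      apply hWz
      rw [hW, Measure.restrict_eq_zero.2 hI0, integral_zero_measure]
    · exact h
  set θ : ℝ := Real.sqrt (W / T) with hθ
  have hθ0 : 0 < θ := Real.sqrt_pos.2 (div_pos hWpos hTpos)
  have hθ2 : θ ^ 2 = W / T := Real.sq_sqrt (div_pos hWpos hTpos).le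
  -- pointwise: `√g ≤ θ/2 + g/(2θ)`
  have hpt : ∀ᵐ t ∂(volume.restrict I), Real.sqrt (g t) ≤ θ / 2 + g t / (2 * θ) := by
    filter_upwards [hg0] with t ht
    have key : Real.sqrt (g t) * (2 * θ) ≤ θ ^ 2 + g t := by
      nlinarith [sq_nonneg (Real.sqrt (g t) - θ), Real.sq_sqrt ht]
    rw [show θ / 2 + g t / (2 * θ) = (θ ^ 2 + g t) / (2 * θ) by field_simp,
      le_div_iff₀ (by positivity)]
    exact key
  have hsqi : IntegrableOn (fun t => Real.sqrt (g t)) I volume := by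
    refine Integrable.mono' ((integrable_const (1 : ℝ)).add hg)
      (Real.continuous_sqrt.comp_aestronglyMeasurable hg.aestronglyMeasurable) ?_
    filter_upwards [hg0] with t ht
    rw [Real.norm_eq_abs, abs_of_nonneg (Real.sqrt_nonneg _)]
    calc Real.sqrt (g t) ≤ Real.sqrt ((1 + g t) ^ 2) := Real.sqrt_le_sqrt (by nlinarith)
      _ = 1 + g t := Real.sqrt_sq (by linarith)
  calc ∫ t in I, Real.sqrt (g t) ≤ ∫ t in I, (θ / 2 + g t / (2 * θ)) :=
        setIntegral_mono_ae_restrict hsqi ((integrable_const _).add (hg.div_const _)) hpt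
    _ = T * (θ / 2) + W / (2 * θ) := by
        rw [integral_add (integrable_const _) (hg.div_const _), setIntegral_const, smul_eq_mul,
          integral_div]
    _ = T * θ := by
        have hWT : W = θ ^ 2 * T := by rw [hθ2]; field_simp
        rw [hWT]; field_simp; ring
    _ = Real.sqrt (T * W) := by
        rw [show T * W = (T * T) * (W / T) by field_simp, Real.sqrt_mul (mul_self_nonneg T),
          Real.sqrt_mul_self hT0]

end Sqrt

/-! ## One slice: cubic + pressure flux density on a shell -/

section SliceFlux

/-- **Flux density of one slice on a shell.**  There are constants `a, b ≥ 0` (depending only on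
the Calderón–Zygmund constant `C_S`, `C_up` and `δ`) such that for every field `V ∈ L² ∩ L³_loc`
on `ℝ³` with `|P||V| ∈ L¹_loc`, the sublinear far-field bound `|V| ≤ C_up |y|^{1−δ}` (`|y| ≥ R₀`),
every `M > 0` with `R₀ ≤ M/8` and the Riesz representation of `P` on `|y| < 16M` at scale `32M`:
`∫_{M ≤ |y| ≤ 2M} (|V|³ + 2|P||V|) ≤ a M^{1−δ} e(T_M) + b M^{−3/2} ‖V‖₂² √(e(T_M))`,
`e(T_M) = ∫_{M/8 ≤ |y| < 32M} |V|²` (the lineage's `shell_cubic_le` and `shell_pressure_le` on the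
larger shell `{M/4 ≤ |y| ≤ 8M}`, scale-explicit). [cite: ChaeShvydkoy2013, §3.1 proof of Thm. 3.1] -/
theorem exists_shell_flux_consts (C_S : ℝ≥0) {δ Cup : ℝ} (hδ1 : δ ≤ 1) (hCup : 0 ≤ Cup) :
    ∃ a b : ℝ, 0 ≤ a ∧ 0 ≤ b ∧
      ∀ (V : EuclideanSpace ℝ (Fin 3) → EuclideanSpace ℝ (Fin 3)) (P : EuclideanSpace ℝ (Fin 3) → ℝ),
        (∀ w : EuclideanSpace ℝ (Fin 3) → EuclideanSpace ℝ (Fin 3), MemLp w 3 volume →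
          MemLp w 4 volume → eLpNorm (rieszPressure w) 2 volume ≤ C_S * eLpNorm w 4 volume ^ 2) →
        AEStronglyMeasurable V volume → Integrable (fun z => ‖V z‖ ^ 2) volume →
        LocallyIntegrable (fun y => ‖V y‖ ^ 3) volume →
        LocallyIntegrable (fun y => |P y| * ‖V y‖) volume →
        ∀ {R₀ : ℝ}, (∀ᵐ y ∂volume, R₀ ≤ ‖y‖ → ‖V y‖ ≤ Cup * ‖y‖ ^ (1 - δ)) →
        ∀ {M : ℝ}, 0 < M → R₀ ≤ M / 8 →
        (∀ᵐ y ∂volume, ‖y‖ < 16 * M →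
          P y = rieszPressure ((ball (0 : EuclideanSpace ℝ (Fin 3)) (32 * M)).indicator V) y +
            ∫ z in {z | 32 * M ≤ ‖z‖}, pressureKernel (y - z) (V z)) →
        ∫ y in {y | M ≤ ‖y‖ ∧ ‖y‖ ≤ 2 * M}, (‖V y‖ ^ 3 + 2 * (|P y| * ‖V y‖)) ≤
          a * M ^ (1 - δ) * (∫ y in {y | M / 8 ≤ ‖y‖ ∧ ‖y‖ < 32 * M}, ‖V y‖ ^ 2) +
            b * M ^ (-(3 / 2 : ℝ)) * (∫ z, ‖V z‖ ^ 2) *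
              Real.sqrt (∫ y in {y | M / 8 ≤ ‖y‖ ∧ ‖y‖ < 32 * M}, ‖V y‖ ^ 2) := by
  set v₁ : ℝ := volume.real (ball (0 : EuclideanSpace ℝ (Fin 3)) 1) with hv₁
  have hv₁0 : 0 ≤ v₁ := measureReal_nonneg
  refine ⟨Cup * ((8 : ℝ) ^ (1 - δ) + 2 * C_S * (32 : ℝ) ^ (1 - δ)),
    4 * (512 * Real.sqrt (512 * v₁) / (2 * Real.pi)), by positivity, by positivity, ?_⟩
  intro V P hCS hVm hV2 hV3 hPV R₀ hup M hM hMR hP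
  set S : Set (EuclideanSpace ℝ (Fin 3)) := {y | M / 4 ≤ ‖y‖ ∧ ‖y‖ ≤ 8 * M} with hS
  set T : Set (EuclideanSpace ℝ (Fin 3)) := {y | M / 8 ≤ ‖y‖ ∧ ‖y‖ < 32 * M} with hT
  have hSm : MeasurableSet S := (measurableSet_le measurable_const measurable_norm).inter
    (measurableSet_le measurable_norm measurable_const)
  have hST : S ⊆ T := fun y hy => ⟨by linarith [hy.1], by linarith [hy.2]⟩
  have hS8 : S ⊆ closedBall (0 : EuclideanSpace ℝ (Fin 3)) (8 * M) := fun y hy => by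
    rw [mem_closedBall, dist_zero_right]; exact hy.2
  set eS : ℝ := ∫ y in S, ‖V y‖ ^ 2 with heS
  set eT : ℝ := ∫ y in T, ‖V y‖ ^ 2 with heT
  set E₂ : ℝ := ∫ z, ‖V z‖ ^ 2 with hE₂
  have heS0 : 0 ≤ eS := setIntegral_nonneg hSm fun y _ => by positivity
  have hE₂0 : 0 ≤ E₂ := integral_nonneg fun z => by positivity
  have heST : eS ≤ eT :=
    setIntegral_mono_set hV2.integrableOn (Eventually.of_forall fun y => by positivity)
      hST.eventuallyLE
  have heT0 : 0 ≤ eT := heS0.trans heST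
  have hcub := shell_cubic_le hV2 hV3 hδ1 hCup hup (L := M) (by linarith)
  have hpre := shell_pressure_le hCS hVm hV2 hV3 hPV hδ1 hCup hup hM hMR hP
  have hvol : volume.real (closedBall (0 : EuclideanSpace ℝ (Fin 3)) (8 * M)) = (8 * M) ^ 3 * v₁ := by
    rw [Measure.addHaar_real_closedBall _ _ (by positivity), finrank_euclideanSpace_fin]
  rw [hvol] at hpre
  -- pass to the larger shell `S` and split the integral
  have hint3 : IntegrableOn (fun y => ‖V y‖ ^ 3) S volume :=
    (hV3.integrableOn_isCompact (isCompact_closedBall 0 (8 * M))).mono_set hS8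
  have hintPV : IntegrableOn (fun y => |P y| * ‖V y‖) S volume :=
    (hPV.integrableOn_isCompact (isCompact_closedBall 0 (8 * M))).mono_set hS8
  have hsmall : ∫ y in {y | M ≤ ‖y‖ ∧ ‖y‖ ≤ 2 * M}, (‖V y‖ ^ 3 + 2 * (|P y| * ‖V y‖)) ≤
      ∫ y in S, (‖V y‖ ^ 3 + 2 * (|P y| * ‖V y‖)) :=
    setIntegral_mono_set (hint3.add (hintPV.const_mul 2))
      (Eventually.of_forall fun y => by positivity)
      (Eventually.of_forall fun y hy => ⟨by linarith [hy.1], by linarith [hy.2]⟩)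
  refine hsmall.trans ?_
  rw [integral_add hint3 (hintPV.const_mul 2), integral_const_mul]
  -- scaling of the constants
  have h8 : (8 * M) ^ (1 - δ) = (8 : ℝ) ^ (1 - δ) * M ^ (1 - δ) := Real.mul_rpow (by norm_num) hM.le
  have h32 : (32 * M) ^ (1 - δ) = (32 : ℝ) ^ (1 - δ) * M ^ (1 - δ) := Real.mul_rpow (by norm_num) hM.le
  have hfar : 1 / (2 * Real.pi * (M / 8) ^ 3) * Real.sqrt ((8 * M) ^ 3 * v₁) =
      512 * Real.sqrt (512 * v₁) / (2 * Real.pi) * M ^ (-(3 / 2 : ℝ)) := by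
    have h := farField_scaling hM hv₁0
    rw [div_eq_iff hM.ne'] at h
    rw [h, mul_assoc, ← Real.rpow_add_one hM.ne']
    norm_num
  have hN : E₂ / (2 * Real.pi * (M / 8) ^ 3) * Real.sqrt ((8 * M) ^ 3 * v₁) =
      E₂ * (512 * Real.sqrt (512 * v₁) / (2 * Real.pi) * M ^ (-(3 / 2 : ℝ))) := by
    rw [← hfar]; ring
  calc (∫ y in S, ‖V y‖ ^ 3) + 2 * ∫ y in S, |P y| * ‖V y‖
      ≤ Cup * (8 * M) ^ (1 - δ) * eS + 2 * (C_S * (Cup * (32 * M) ^ (1 - δ)) * eT +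
          2 * (E₂ / (2 * Real.pi * (M / 8) ^ 3)) * Real.sqrt ((8 * M) ^ 3 * v₁) * Real.sqrt eS) :=
        add_le_add hcub (mul_le_mul_of_nonneg_left hpre (by norm_num))
    _ ≤ Cup * (8 * M) ^ (1 - δ) * eT + 2 * (C_S * (Cup * (32 * M) ^ (1 - δ)) * eT +
          2 * (E₂ / (2 * Real.pi * (M / 8) ^ 3)) * Real.sqrt ((8 * M) ^ 3 * v₁) * Real.sqrt eT) := by
        gcongr
    _ = Cup * ((8 : ℝ) ^ (1 - δ) + 2 * C_S * (32 : ℝ) ^ (1 - δ)) * M ^ (1 - δ) * eT +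
          4 * (512 * Real.sqrt (512 * v₁) / (2 * Real.pi)) * M ^ (-(3 / 2 : ℝ)) * E₂ *
            Real.sqrt eT := by
        rw [h8, h32]
        have : 2 * (E₂ / (2 * Real.pi * (M / 8) ^ 3)) * Real.sqrt ((8 * M) ^ 3 * v₁) =
            2 * (E₂ / (2 * Real.pi * (M / 8) ^ 3) * Real.sqrt ((8 * M) ^ 3 * v₁)) := by ring
        rw [this, hN]
        ring

end SliceFlux

end Summit.NavierStokesRegularity.NavierStokesRegularity.Theorems.PowerGaugeEulerLiouville
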